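import Summits.BirchSwinnertonDyer.BirchSwinnertonDyer.Theorems.KimAtThreeKolyvaginIsogenyCruxes
import Summits.BirchSwinnertonDyer.BirchSwinnertonDyer.Theorems.KimAtThreeDeepLowerKatoStratumOfFacts
import Summits.BirchSwinnertonDyer.BirchSwinnertonDyer.Theorems.KimAtThreeKolyvaginDeepLowerKatoStratumShallow
import HarnessLib

/-!
# Route `KimAtThreeKolyvagin` (rung W2): the Kato-stratum rungs of cruxes 19075 / 19077 hold CLASS-WIDE
# (every curve `ℚ`-isogenous to the optimal parametrised curve, not only the optimal curve itself)

Cell `bsd-addord`, seat `bsd-addord-kim3` (gen 9). TOOL FILE: theorems only (no definition, no named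
fact, no `sorry`); closes nothing, books nothing. First CONSUMERS of the transport files
`KimAtThreeKolyvaginIsogeny{Invariance,Transport,Cruxes}` (p423783 / p424702 / p425479): the cell's
Kato-stratum rungs — w2-c2's `deepLower_optimal_of_ports_of_poitouTate` (crux 19075's conclusion for an
OPTIMAL datum `D₀` of `W₀` at the conductor, granted [S24] (1)(2), GZK, Poitou–Tate and the repaired
dictionary port PORT″ `KatoKuriharaPortThreeAtWith₂ W₀ 0 v₃ η D₀`) and kim3 g8's
`shallowEqDeep_conclusion_of_ports_of_deepUpper` (19077's conclusion ⟸ 19076's on the same stratum) —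
are re-stated for EVERY globally minimal `W` that is `ℚ`-isogenous to `W₀`, with the ROW binders
(tower onto, additive `3`, `E(ℚ₃)[3] = 0`, `ord(δ̃) = 0`, and for 19077 the 19076-conclusion) read at
`W` itself; only the DATUM binders (`3 ∤ c₃(W₀)`, `3 ∤ c_{D₀}`, optimality, the port) stay at `W₀`.
Transport: `towerSurjective_of_isIsogenous`, `addv_iff_of_isIsogenous`,
`natCard_torsion_padic_eq_of_isIsogenous`, `kuriharaVanishingOrder_eq_of_isIsogenous`,
`deepLower/deepUpper/shallowEqDeep_conclusion_iff_of_isIsogenous` (E[3] irreducible under the tower).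

References: [Kim2025RefinedTNC] Thm 1.1; [Sakamoto2024] Thm. 4.4; [MilneADT2006] I Thm. 4.10;
[Kim2022StructureSelmer] Thm. 1.9 (6), Thm. 3.13; [SilvermanAEC2009] III.4.11, VII.7.2; memo
`run/shared/lean/pub/bsd-addord/kim3/KIM3-W2-ISOGENY-g9.md`.
-/

-- the Theorems namespace of a single-conjunct summit repeats the summit name by design (D-0017)
set_option linter.dupNamespace false

noncomputable section

open scoped Classical NumberField
open Function Field NumberField IsDedekindDomain WeierstrassCurve CongruenceSubgroup
  Literature.NumberTheory.EllipticCurves Literature.NumberTheory.EllipticCurves.ModularForms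
  Literature.NumberTheory.EllipticCurves.Rank1Residual
  Literature.NumberTheory.GaloisRepresentations Literature.NumberTheory.GaloisCohomology
  Summit.BirchSwinnertonDyer.Rank1Residual.GaloisImage Summit.BirchSwinnertonDyer.Rank1Residual.X4
  Summit.BirchSwinnertonDyer.BirchSwinnertonDyer.Theorems.KimAtThreeKolyvaginIsogenyInvariance
  Summit.BirchSwinnertonDyer.BirchSwinnertonDyer.Theorems.KimAtThreeKolyvaginIsogenyTransport
  Summit.BirchSwinnertonDyer.BirchSwinnertonDyer.Theorems.KimAtThreeKolyvaginIsogenyCruxes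
  Summit.BirchSwinnertonDyer.BirchSwinnertonDyer.Theorems.KimAtThreeDeepLowerKatoStratumOfFacts
  Summit.BirchSwinnertonDyer.BirchSwinnertonDyer.Theorems.KimAtThreeKolyvaginDeepLowerKatoStratumShallow

namespace Summit.BirchSwinnertonDyer.BirchSwinnertonDyer.Theorems.KimAtThreeKolyvaginIsogenyKatoStratum

/-- **Crux 19075 (`DeepLowerAtThree`) on the Kato stratum, CLASS-WIDE.** Let `W₀` be a globally minimal
elliptic curve carrying an OPTIMAL parametrisation datum `D₀` at its conductor with `3 ∤ c_{D₀}` and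
`3 ∤ c₃(W₀)`, and the repaired dictionary port PORT″ at `(v₃, η, D₀)`; let `W` be ANY globally minimal
curve `ℚ`-isogenous to `W₀` with the `3`-adic tower onto, additive at `3`, `E(ℚ₃)[3] = 0` and
`ord(δ̃) = 0` for `D₀.f` (the newform of the class). Then, GRANTED [S24] (1)(2), GZK and Poitou–Tate:
`∂^{(∞)}_deep = d ∈ ℕ` and `∂⁽⁰⁾ ≤ ord₃ #Ш(W)(3) + d` — w2-c2's `deepLower_optimal_of_ports_of_poitouTate`
at `W₀` (row binders transported to `W₀`, conclusion transported back to `W`). [cite: Kim2025RefinedTNC, Thm 1.1]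
[cite: Sakamoto2024, Thm. 4.4 (p. 926)] [cite: MilneADT2006, Ch. I, Thm. 4.10] [cite: SilvermanAEC2009, Cor. III.4.11] -/
theorem deepLower_conclusion_classwide_of_ports_of_poitouTate
    (hS24 : Sakamoto2024.kolyvaginSystems_freeRankOne_zmod_three_pow)
    (hS24₂ : Sakamoto2024.kolyvaginSystems_idealOfBasis_eq_fittingIdeal_zmod_three_pow)
    (hGZK : rank_eq_analyticRank_of_analyticRank_le_one)
    (hPT : poitouTate_selmerStructure_duality ℚ)
    (W W₀ : WeierstrassCurve ℚ) [W.IsElliptic] [W.IsGloballyMinimal] [W₀.IsElliptic]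
    [W₀.IsGloballyMinimal] (hiso : IsIsogenous W W₀)
    -- the row, read at `W`
    (hadd : haveI : Fact (Nat.Prime 3) := ⟨Nat.prime_three⟩; Addv W 3)
    (htower : ∀ m : ℕ, W.HasSurjectiveModNGaloisRep (3 ^ m : ℕ))
    (ht0 : Nat.card {Q : (W.baseChange ℚ_[3]).toAffine.Point // (3 : ℕ) • Q = 0} = 1)
    -- the optimal datum of the class, at `W₀`
    (hc3 : ¬ 3 ∣ (W₀.baseChange ℚ_[3]).localTamagawaNumber ℤ_[3])
    {N : ℕ} [NeZero N] (hN : N = W₀.conductorNorm ℤ) (D₀ : ModularParametrizationData W₀ N)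
    (hopt : ∀ z ∈ D₀.L.lattice, ∃ w ∈ periodLattice D₀.f, z = D₀.c * w)
    (hcD : ¬ (3 : ℤ) ∣ D₀.maninConstant)
    (v₃ : HeightOneSpectrum (𝓞 ℚ)) (hv₃ : ((3 : ℕ) : 𝓞 ℚ) ∈ v₃.asIdeal)
    (η : (q : HeightOneSpectrum (𝓞 ℚ)) → (ZMod (Ideal.absNorm q.asIdeal))ˣ)
    (hη : ∀ q : HeightOneSpectrum (𝓞 ℚ), Subgroup.zpowers (η q) = ⊤)
    (hPort : KatoKuriharaPortThreeAtWith₂ W₀ 0 v₃ η D₀)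
    (hord : kuriharaVanishingOrder W 3 D₀.f = 0) :
    ∃ d : ℕ, kuriharaPartialDeepInfty W 3 D₀.f = d ∧
      kuriharaPartial W 3 D₀.f 0 ≤
        ((padicValNat 3 (Nat.card (AddCommGroup.primaryComponent W.sha 3)) + d : ℕ) : ℕ∞) := by
  haveI : Fact (Nat.Prime 3) := ⟨Nat.prime_three⟩
  have hirr : W.HasIrreducibleModPGaloisRep 3 := hasIrreducibleModPGaloisRep_of_tower htower
  have h₀ := deepLower_optimal_of_ports_of_poitouTate hS24 hS24₂ hGZK hPT W₀
    ((addv_iff_of_isIsogenous hiso).mp hadd) hc3 (towerSurjective_of_isIsogenous hiso htower)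
    (by rw [← natCard_torsion_padic_eq_of_isIsogenous hiso hirr]; exact ht0) hN D₀ hopt hcD v₃ hv₃ η hη hPort
    (by rw [← kuriharaVanishingOrder_eq_of_isIsogenous D₀.f hiso hirr]; exact hord)
  exact (deepLower_conclusion_iff_of_isIsogenous D₀.f hiso hirr).mpr h₀

/-- **19077 ⟸ 19076 on the Kato stratum, CLASS-WIDE.** Same `W₀`, `D₀` (optimal, `3 ∤ c_{D₀}`,
`3 ∤ c₃(W₀)`, port at `(v₃, η, D₀)`); for ANY globally minimal `W ~ W₀` with the tower onto, additive
`3`, `E(ℚ₃)[3] = 0`, `ord(δ̃) = 0`: if crux 19076's conclusion holds at `W` (`ord₃ #Ш(W)(3) + d ≤ ∂⁽⁰⁾`)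
then so does crux 19077's (`∂^{(∞)}_deep ≤ ∂^{(∞)}`), GRANTED [S24] (1)(2), GZK, Poitou–Tate — kim3
g8's `shallowEqDeep_conclusion_of_ports_of_deepUpper` at `W₀` with the Poitou–Tate families from the
named fact and both crux conclusions transported along `W ~ W₀`. [cite: Kim2025RefinedTNC, Thm 1.1]
[cite: Sakamoto2024, Thm. 4.4 (p. 926)] [cite: MilneADT2006, Ch. I, Thm. 4.10] [cite: SilvermanAEC2009, Cor. III.4.11] -/
theorem shallowEqDeep_conclusion_classwide_of_ports_of_deepUpper
    (hS24 : Sakamoto2024.kolyvaginSystems_freeRankOne_zmod_three_pow)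
    (hS24₂ : Sakamoto2024.kolyvaginSystems_idealOfBasis_eq_fittingIdeal_zmod_three_pow)
    (hGZK : rank_eq_analyticRank_of_analyticRank_le_one)
    (hPT : poitouTate_selmerStructure_duality ℚ)
    (W W₀ : WeierstrassCurve ℚ) [W.IsElliptic] [W.IsGloballyMinimal] [W₀.IsElliptic]
    [W₀.IsGloballyMinimal] (hiso : IsIsogenous W W₀)
    (hadd : haveI : Fact (Nat.Prime 3) := ⟨Nat.prime_three⟩; Addv W 3)
    (htower : ∀ m : ℕ, W.HasSurjectiveModNGaloisRep (3 ^ m : ℕ))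
    (ht0 : Nat.card {Q : (W.baseChange ℚ_[3]).toAffine.Point // (3 : ℕ) • Q = 0} = 1)
    (hc3 : ¬ 3 ∣ (W₀.baseChange ℚ_[3]).localTamagawaNumber ℤ_[3])
    {N : ℕ} [NeZero N] (hN : N = W₀.conductorNorm ℤ) (D₀ : ModularParametrizationData W₀ N)
    (hopt : ∀ z ∈ D₀.L.lattice, ∃ w ∈ periodLattice D₀.f, z = D₀.c * w)
    (hcD : ¬ (3 : ℤ) ∣ D₀.maninConstant)
    (v₃ : HeightOneSpectrum (𝓞 ℚ)) (hv₃ : ((3 : ℕ) : 𝓞 ℚ) ∈ v₃.asIdeal)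
    (η : (q : HeightOneSpectrum (𝓞 ℚ)) → (ZMod (Ideal.absNorm q.asIdeal))ˣ)
    (hη : ∀ q : HeightOneSpectrum (𝓞 ℚ), Subgroup.zpowers (η q) = ⊤)
    (hPort : KatoKuriharaPortThreeAtWith₂ W₀ 0 v₃ η D₀)
    (hord : kuriharaVanishingOrder W 3 D₀.f = 0)
    (hU : ∃ d : ℕ, kuriharaPartialDeepInfty W 3 D₀.f = d ∧
      ((padicValNat 3 (Nat.card (AddCommGroup.primaryComponent W.sha 3)) + d : ℕ) : ℕ∞) ≤
        kuriharaPartial W 3 D₀.f 0) :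
    kuriharaPartialDeepInfty W 3 D₀.f ≤ kuriharaPartialInfty W 3 D₀.f := by
  haveI : Fact (Nat.Prime 3) := ⟨Nat.prime_three⟩
  have hirr : W.HasIrreducibleModPGaloisRep 3 := hasIrreducibleModPGaloisRep_of_tower htower
  obtain ⟨inv, hperf, hsum, -, hcompl⟩ := hPT 3
  obtain ⟨inv', hperf', hsum', hcompl', hinj'⟩ := exists_localInvariants_three_pow_of_poitouTate hPT
  have h₀ := shallowEqDeep_conclusion_of_ports_of_deepUpper hS24 hS24₂ hGZK W₀
    ((addv_iff_of_isIsogenous hiso).mp hadd) hc3 (towerSurjective_of_isIsogenous hiso htower)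
    (by rw [← natCard_torsion_padic_eq_of_isIsogenous hiso hirr]; exact ht0) hN D₀ hcD
    (periodTransfer_of_optimal 3 D₀ hopt hcD) inv hperf hsum hcompl inv' hperf' hsum' hcompl' hinj' v₃ hv₃ η hη
    hPort (by rw [← kuriharaVanishingOrder_eq_of_isIsogenous D₀.f hiso hirr]; exact hord)
    ((deepUpper_conclusion_iff_of_isIsogenous D₀.f hiso hirr).mp hU)
  exact (shallowEqDeep_conclusion_iff_of_isIsogenous D₀.f hiso hirr).mpr h₀

end Summit.BirchSwinnertonDyer.BirchSwinnertonDyer.Theorems.KimAtThreeKolyvaginIsogenyKatoStratum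

end
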